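import Mathlib
import HarnessLib
import Literature.Analysis.Convex.DouglasRachfordSplitting
import Literature.Analysis.Convex.AveragedOperators

/-!
# Tight global linear convergence rate bounds for Douglas–Rachford splitting (Giselsson 2017)

Literature anchor (statements and proofs follow the source; nothing here is new mathematics):

* [Gis17] P. Giselsson, *Tight global linear convergence rate bounds for Douglas–Rachford
  splitting*, J. Fixed Point Theory Appl. **19** (2017) 2241–2270,
  doi:10.1007/s11784-017-0417-1, arXiv:1506.01556 (bib key `Giselsson2017`; held copy, `lit` key
  `paper:arxiv-1506.01556`; numbering of the journal = arXiv v6 version): §2.2 Definitions 2.1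
  (strong monotonicity), 2.2 (Lipschitz), 2.4 (contractive), 2.5 (averaged), 2.6 (cocoercive);
  §3.1 Lemmas 3.1, 3.3, 3.5, 3.6; §3.2 Definition 3.7 (negatively averaged operators),
  Propositions 3.9, 3.10, 3.12; §4 the (relaxed) Douglas–Rachford iteration
  `z^{k+1} = ((1 − α) Id + α R_A R_B) z^k`, `R_A = 2J_A − Id`, `J_A = (A + Id)⁻¹`, applied to
  `0 ∈ γAx + γBx`; §5 (A strongly monotone, B cocoercive) Propositions 5.2–5.5, Theorem 5.6;
  §6 (A strongly monotone and Lipschitz) Proposition 6.2, Theorem 6.3, Proposition 6.4,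
  Theorem 6.5; §7 (A strongly monotone and cocoercive) Theorem 7.2, Proposition 7.3, Theorem 7.4.
* [Ber07] V. Berinde, *Iterative Approximation of Fixed Points*, LNM 1912, Springer 2007,
  Ch. 2 Thm 2.1 (Banach's contraction mapping principle with the rate `d(x_n, x*) ≤ aⁿ d(x_0, x*)`)
  — used only to turn a contraction factor into "converges linearly with rate factor".

THE RESULTS [Gis17].  Let `A`, `B` be maximally monotone on a real Hilbert space and consider the
relaxed Douglas–Rachford ("averaged reflect-reflect") iteration
`z⁺ = (1 − α) z + α R_{γA} R_{γB} z`.  (§5) If `A` is `σ`-strongly monotone and `B` is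
`1/β`-cocoercive then `R_{γA}` is `1/(1 + γσ)`-NEGATIVELY AVERAGED (i.e. `−R_{γA}` is averaged,
Def 3.7, Prop 5.4), `R_{γB}` is `γβ/(1 + γβ)`-averaged (Prop 5.3), the composition is
`θ`-negatively averaged with `θ = (1/(γσ) + γβ)/(1 + 1/(γσ) + γβ)` (Prop 3.12, Prop 5.5), and the
iteration map is a contraction with factor `|1 − 2α + αθ| + αθ < 1` for `α ∈ (0, 1)` (Prop 3.9,
Thm 5.6).  (§6) If `A` is single-valued, `σ`-strongly monotone and `β`-Lipschitz then `R_{γA}` is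
`δ`-contractive with `δ = √(1 − 4γσ/(1 + 2γσ + (γβ)²))` (Thm 6.3; `γ = 1/β` is optimal and gives
`√((β/σ − 1)/(β/σ + 1))`, Prop 6.4), hence the iteration map contracts with factor
`|1 − α| + αδ` for `α ∈ (0, 2/(1 + δ))` (Lemma 3.3, Thm 6.5).  (§7) If `A` is `σ`-strongly
monotone and `1/β`-cocoercive then `δ = √(1 − 4γσ/(1 + 2γσ + γ²σβ))` (Thm 7.2; `γ = 1/√(βσ)`
optimal, Prop 7.3; Thm 7.4).  A contraction factor `ρ < 1` of the iteration map means: a unique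
fixed point `z̄`, `‖z^k − z̄‖ ≤ ρ^k ‖z^0 − z̄‖`, and the "shadow" `x^k = J_{γB} z^k` converges to
the unique zero `J_{γB} z̄` of `A + B` at the same rate.

## What is formalised (namespace `Literature.Analysis.Convex.DouglasRachfordLinearRate`)

Operators are subsets of `H × H` over a real inner product space as in
`Literature.Analysis.Convex.MonotoneOperator`; the resolvent maps `ja = J_{γA}`, `jb = J_{γB}`
are data with `IsResolventMap γ A ja` (what maximality provides); `R_{γA} R_{γB}` is
`DouglasRachford.reflComp ja jb`, the iteration is
`KrasnoselskijIteration.kmIter (reflComp ja jb) α` (for `α = 1/2` the classical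
`DouglasRachford.drIter`), averagedness is `AveragedOperators.IsAveraged`, cocoercivity is
`BaillonHaddad.IsCocoercive`.

* `IsStronglyMonotone σ A` (Def 2.1) with `isMonotone`, the `graph` form and uniqueness of the
  zero of `A + B`; `IsNegAveraged θ T` (Def 3.7) with its `ν`-form (eq. (3.3) of the source).
* Lemma 3.1 (`isCocoercive_smul_add_iff_lipschitz`), Lemma 3.3
  (`norm_averagedMap_sub_le_of_lipschitz`, `rate_lt_one_of_contractive`), Lemma 3.5
  (`isAveraged_two_smul_sub`), Lemma 3.6 (`isCocoercive_of_isStronglyMonotone`), Prop 3.9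
  (`IsNegAveraged.norm_averagedMap_sub_le`, `negAvgRate_lt_one`), Prop 3.10 (`negAvgRate_opt`,
  `negAvgRate_ge_opt`), Prop 3.12 (`IsNegAveraged.comp`).
* §5: Prop 5.2 (`isAveraged_resolventMap_of_isCocoercive`), 5.3, 5.4, 5.5, Thm 5.6
  (`norm_kmStep_sub_le_of_sm_coco` and the packaged `linearRate_of_sm_coco`).
* §6: Prop 6.2, Thm 6.3 (`norm_reflect_sub_le_of_sm_lipschitz`, constant `lipContr γ σ β`),
  Prop 6.4 (`lipContr_sq_at_inv`, `lipContr_sq_opt_le`), Thm 6.5 (`linearRate_of_sm_lipschitz`,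
  `linearRate_drIter_of_sm_lipschitz`).
* §7: Thm 7.2 (`norm_reflect_sub_le_of_sm_coco`, constant `cocoContr γ σ β`), Prop 7.3
  (`cocoContr_sq_at_invSqrt`, `cocoContr_sq_opt_le`), Thm 7.4 (`linearRate_of_sm_coco_same`).
* Packaging via Banach's fixed point theorem [Ber07, Ch. 2, Thm 2.1]:
  `exists_fixedPoint_of_contractive`, `norm_iterate_sub_le_of_contractive`,
  `tendsto_iterate_of_contractive`, `linearRate_of_contractive`.

NOT formalised: the tightness examples and lower bounds (§5.1 Prop 5.7, §6.1 Props 6.6–6.9,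
§7.1 Props 7.5–7.7), the comparisons §5.2/6.2/7.2, Lemmas 3.2 and 3.4 (special cases of [BC11]
already in `AveragedOperators`), Remark 3.13 (`N` factors), the closed-form optimisation over
`(α, γ)` in Thms 5.6/6.5/7.4 beyond the identities recorded in Props 3.10/6.4/7.3, and weak
convergence (everything here is in norm).  In §6–§7 the source takes `A` single-valued with full
domain; here `A = graph a` for a map `a : H → H`.
-/

noncomputable section

open Filter Topology
open scoped RealInnerProductSpace
open Literature.Analysis.Convex.KrasnoselskijIteration
open Literature.Analysis.Convex.MonotoneOperator
open Literature.Analysis.Convex.DouglasRachford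
open Literature.Analysis.Convex.BaillonHaddad
open Literature.Analysis.Convex.AveragedOperators

namespace Literature.Analysis.Convex.DouglasRachfordLinearRate

variable {H : Type*} [NormedAddCommGroup H] [InnerProductSpace ℝ H]

/-! ## Definition 2.1: strong monotonicity [Gis17, §2.2] -/

/-- `A` is `σ`-STRONGLY MONOTONE: `⟨u − v, x − y⟩ ≥ σ‖x − y‖²` for all `(x, u), (y, v) ∈ gph A`
("merely monotone if `σ = 0`"). [cite: Giselsson2017, Def 2.1] -/
def IsStronglyMonotone (σ : ℝ) (A : Set (H × H)) : Prop :=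
  ∀ ⦃x u : H⦄, (x, u) ∈ A → ∀ ⦃y v : H⦄, (y, v) ∈ A → σ * ‖y - x‖ ^ 2 ≤ ⟪y - x, v - u⟫

variable {A B : Set (H × H)} {σ σ' β c α θ : ℝ}

/-- "The operator is merely monotone if `σ = 0`". [cite: Giselsson2017, Def 2.1] -/
theorem isStronglyMonotone_zero_iff : IsStronglyMonotone 0 A ↔ IsMonotone A := by
  simp only [IsStronglyMonotone, IsMonotone, zero_mul]

/-- A `σ`-strongly monotone operator with `σ ≥ 0` is monotone. [cite: Giselsson2017, Def 2.1] -/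
theorem IsStronglyMonotone.isMonotone (h : IsStronglyMonotone σ A) (hσ : 0 ≤ σ) :
    IsMonotone A :=
  fun _ _ hxu _ _ hyv => (mul_nonneg hσ (sq_nonneg _)).trans (h hxu hyv)

/-- Monotonicity in the constant. [cite: Giselsson2017, Def 2.1] -/
theorem IsStronglyMonotone.mono (h : IsStronglyMonotone σ A) (hle : σ' ≤ σ) :
    IsStronglyMonotone σ' A :=
  fun _ _ hxu _ _ hyv => (mul_le_mul_of_nonneg_right hle (sq_nonneg _)).trans (h hxu hyv)

/-- Strong monotonicity of a single-valued `a : H → H` (the setting of §6–§7):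
`σ‖x − y‖² ≤ ⟨x − y, a x − a y⟩`. [cite: Giselsson2017, Def 2.1] -/
theorem isStronglyMonotone_graph_iff {a : H → H} :
    IsStronglyMonotone σ (graph a) ↔ ∀ x y, σ * ‖x - y‖ ^ 2 ≤ ⟪x - y, a x - a y⟫ := by
  constructor
  · intro h x y
    exact h (mem_graph_iff.2 rfl) (mem_graph_iff.2 rfl)
  · intro h x u hxu y v hyv
    rw [mem_graph_iff] at hxu hyv
    rw [hxu, hyv]
    exact h y x

/-- If `A` is `σ`-strongly monotone with `σ > 0` and `B` is monotone then `A + B` has at most one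
zero (the solution of `0 ∈ Ax + Bx` in §4 is unique). [cite: Giselsson2017, Def 2.1 and §4] -/
theorem IsStronglyMonotone.subsingleton_zer_opSum (hA : IsStronglyMonotone σ A) (hσ : 0 < σ)
    (hB : IsMonotone B) : (zer (opSum A B)).Subsingleton := by
  intro x hx x' hx'
  rw [mem_zer_iff] at hx hx'
  obtain ⟨u, v, hu, hv, e⟩ := hx
  obtain ⟨u', v', hu', hv', e'⟩ := hx'
  have h1 := hA hu hu'
  have h2 := hB hv hv'
  have huv : u' - u = -(v' - v) := by
    have eu : u = -v := eq_neg_of_add_eq_zero_left e.symm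
    have eu' : u' = -v' := eq_neg_of_add_eq_zero_left e'.symm
    rw [eu, eu']; abel
  rw [huv, inner_neg_right] at h1
  have h3 : ‖x' - x‖ ^ 2 ≤ 0 := by nlinarith
  have h4 : x' - x = 0 := by
    rw [← norm_eq_zero]
    exact le_antisymm (by nlinarith [norm_nonneg (x' - x)]) (norm_nonneg _)
  exact (sub_eq_zero.1 h4).symm

/-! ## Scalar helpers [folklore] -/

omit [InnerProductSpace ℝ H] in
/-- From `‖p‖² ≤ f‖q‖²` to `‖p‖ ≤ √f ‖q‖`. [folklore] -/
private theorem norm_le_sqrt_mul {p q : H} {f : ℝ} (h : ‖p‖ ^ 2 ≤ f * ‖q‖ ^ 2) :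
    ‖p‖ ≤ Real.sqrt f * ‖q‖ := by
  have := Real.sqrt_le_sqrt h
  rwa [Real.sqrt_sq (norm_nonneg _), Real.sqrt_mul' f (sq_nonneg _),
    Real.sqrt_sq (norm_nonneg _)] at this

/-- `‖d + c e‖² = ‖d‖² + 2c⟨d, e⟩ + c²‖e‖²`. [folklore] -/
private theorem norm_add_smul_sq (d e : H) (c : ℝ) :
    ‖d + c • e‖ ^ 2 = ‖d‖ ^ 2 + 2 * c * ⟪d, e⟫ + c ^ 2 * ‖e‖ ^ 2 := by
  rw [norm_add_sq_real, norm_smul, real_inner_smul_right, Real.norm_eq_abs, mul_pow, sq_abs]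
  ring

/-- `‖d − c e‖² = ‖d‖² − 2c⟨d, e⟩ + c²‖e‖²`. [folklore] -/
private theorem norm_sub_smul_sq (d e : H) (c : ℝ) :
    ‖d - c • e‖ ^ 2 = ‖d‖ ^ 2 - 2 * c * ⟪d, e⟫ + c ^ 2 * ‖e‖ ^ 2 := by
  rw [norm_sub_sq_real, norm_smul, real_inner_smul_right, Real.norm_eq_abs, mul_pow, sq_abs]
  ring

/-- `⟨d + c e, d⟩ = ‖d‖² + c⟨d, e⟩`. [folklore] -/
private theorem inner_add_smul_self (d e : H) (c : ℝ) :
    ⟪d + c • e, d⟫ = ‖d‖ ^ 2 + c * ⟪d, e⟫ := by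
  rw [inner_add_left, real_inner_smul_left, real_inner_self_eq_norm_sq, real_inner_comm d e]

/-- Young: `‖p + q‖² ≤ (1 + t)‖p‖² + (1 + t⁻¹)‖q‖²` for `t > 0` ("convexity of `‖·‖²`" in the
proof of Prop 3.12). [folklore] -/
private theorem norm_add_sq_le_young (p q : H) {t : ℝ} (ht : 0 < t) :
    ‖p + q‖ ^ 2 ≤ (1 + t) * ‖p‖ ^ 2 + (1 + t⁻¹) * ‖q‖ ^ 2 := by
  have h0 : 0 ≤ ‖t • p - q‖ ^ 2 := sq_nonneg _
  rw [norm_sub_sq_real, norm_smul, real_inner_smul_left, Real.norm_eq_abs, abs_of_pos ht,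
    mul_pow] at h0
  rw [norm_add_sq_real]
  have key : t * (2 * ⟪p, q⟫) ≤ t * (t * ‖p‖ ^ 2 + t⁻¹ * ‖q‖ ^ 2) := by
    have e : t * (t * ‖p‖ ^ 2 + t⁻¹ * ‖q‖ ^ 2) = t ^ 2 * ‖p‖ ^ 2 + ‖q‖ ^ 2 := by
      field_simp
    rw [e]
    linarith
  have h1 := le_of_mul_le_mul_left key ht
  linarith

/-- The resolvent relation for a single-valued operator: `j z + c·a(j z) = z`.
[cite: Giselsson2017, §4 (J_A = (A + Id)⁻¹)] -/
theorem apply_add_smul_eq_of_graph {a j : H → H} (hj : IsResolventMap c (graph a) j) (z : H) :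
    j z + c • a (j z) = z := by
  obtain ⟨y, hy, e⟩ := hj.exists_mem z
  rw [mem_graph_iff] at hy
  rw [hy] at e
  exact e

/-- `x − y = (j x − j y) + c (a(j x) − a(j y))` for the resolvent map of a single-valued `a`.
[cite: Giselsson2017, §10 proof of Prop 5.2 (x = u + Bu)] -/
theorem sub_eq_of_graph {a j : H → H} (hj : IsResolventMap c (graph a) j) (x y : H) :
    x - y = (j x - j y) + c • (a (j x) - a (j y)) := by
  have e : (j x + c • a (j x)) - (j y + c • a (j y)) = x - y := by
    rw [apply_add_smul_eq_of_graph hj x, apply_add_smul_eq_of_graph hj y]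
  rw [← e, smul_sub]
  abel

/-- `R x − R y = (j x − j y) − c (a(j x) − a(j y))` for `R = 2J − Id`.
[cite: Giselsson2017, §11 proof of Thm 6.3] -/
theorem reflect_sub_eq_of_graph {a j : H → H} (hj : IsResolventMap c (graph a) j) (x y : H) :
    ((2 : ℝ) • j x - x) - ((2 : ℝ) • j y - y) = (j x - j y) - c • (a (j x) - a (j y)) := by
  have e : ((2 : ℝ) • j x - x) - ((2 : ℝ) • j y - y) = (2 : ℝ) • (j x - j y) - (x - y) := by
    rw [smul_sub]; abel
  rw [e, sub_eq_of_graph hj x y, two_smul]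
  abel

/-! ## §3.1 Useful lemmas [Gis17, Lemmas 3.1, 3.3, 3.5, 3.6] -/

/-- LEMMA 3.1: for `β > 0`, `βId + T` is `1/(2β)`-cocoercive iff `T` is `β`-Lipschitz.
[cite: Giselsson2017, Lemma 3.1] -/
theorem isCocoercive_smul_add_iff_lipschitz {T : H → H} (hβ : 0 < β) :
    IsCocoercive (1 / (2 * β)) (fun x => β • x + T x) ↔ ∀ x y, ‖T x - T y‖ ≤ β * ‖x - y‖ := by
  simp only [IsCocoercive]
  refine forall₂_congr fun x y => ?_
  have e : (β • x + T x) - (β • y + T y) = β • (x - y) + (T x - T y) := by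
    rw [smul_sub]; abel
  rw [e, ← sq_le_sq₀ (norm_nonneg _) (mul_nonneg hβ.le (norm_nonneg _)), norm_add_sq_real,
    inner_add_right, norm_smul, real_inner_smul_left, real_inner_smul_right,
    real_inner_self_eq_norm_sq, Real.norm_eq_abs, abs_of_pos hβ, mul_pow,
    one_div_mul_eq_div, div_le_iff₀ (by positivity)]
  constructor <;> intro h <;> linarith

/-- LEMMA 3.3 (Lipschitz constant): if `T` is `δ`-Lipschitz then `(1 − α)Id + αT` is
`(|1 − α| + αδ)`-Lipschitz (`α ≥ 0`). [cite: Giselsson2017, Lemma 3.3] -/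
theorem norm_averagedMap_sub_le_of_lipschitz {T : H → H} {δ : ℝ}
    (hT : ∀ x y, ‖T x - T y‖ ≤ δ * ‖x - y‖) (hα : 0 ≤ α) (x y : H) :
    ‖averagedMap T α x - averagedMap T α y‖ ≤ (|1 - α| + α * δ) * ‖x - y‖ := by
  have e : averagedMap T α x - averagedMap T α y = (1 - α) • (x - y) + α • (T x - T y) := by
    simp only [averagedMap, smul_sub]; abel
  rw [e]
  calc ‖(1 - α) • (x - y) + α • (T x - T y)‖
      ≤ ‖(1 - α) • (x - y)‖ + ‖α • (T x - T y)‖ := norm_add_le _ _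
    _ = |1 - α| * ‖x - y‖ + α * ‖T x - T y‖ := by
        rw [norm_smul, norm_smul, Real.norm_eq_abs, Real.norm_eq_abs, abs_of_nonneg hα]
    _ ≤ |1 - α| * ‖x - y‖ + α * (δ * ‖x - y‖) := by
        have := mul_le_mul_of_nonneg_left (hT x y) hα
        linarith
    _ = (|1 - α| + α * δ) * ‖x - y‖ := by ring

/-- LEMMA 3.3 (contractiveness): for `δ ∈ [0, 1)` and `α ∈ (0, 2/(1 + δ))`,
`|1 − α| + αδ < 1`. [cite: Giselsson2017, Lemma 3.3] -/
theorem rate_lt_one_of_contractive {δ : ℝ} (hδ0 : 0 ≤ δ) (hδ1 : δ < 1) (hα0 : 0 < α)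
    (hα : α < 2 / (1 + δ)) : |1 - α| + α * δ < 1 := by
  rcases le_or_gt α 1 with h | h
  · rw [abs_of_nonneg (by linarith)]
    have := mul_lt_mul_of_pos_left hδ1 hα0
    linarith
  · rw [abs_of_neg (by linarith)]
    have : α * (1 + δ) < 2 := by rwa [lt_div_iff₀ (by linarith)] at hα
    linarith

/-- `0 ≤ |1 − α| + αδ` for `α, δ ≥ 0`. [cite: Giselsson2017, Lemma 3.3] -/
theorem rate_nonneg_of_contractive {δ : ℝ} (hδ0 : 0 ≤ δ) (hα : 0 ≤ α) :
    0 ≤ |1 - α| + α * δ :=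
  add_nonneg (abs_nonneg _) (mul_nonneg hα hδ0)

/-- LEMMA 3.5 (algebraic form, any `α`): if `T = (1 − α)Id + αR` then
`2T − Id = (1 − 2α)Id + 2αR`, so `2T − Id` is `2α`-averaged. [cite: Giselsson2017, Lemma 3.5] -/
theorem isAveraged_two_smul_sub {T : H → H} (h : IsAveraged α T) :
    IsAveraged (2 * α) (fun x => (2 : ℝ) • T x - x) := by
  obtain ⟨R, hR, hT⟩ := h
  refine ⟨R, hR, fun x => ?_⟩
  show (2 : ℝ) • T x - x = (1 - 2 * α) • x + (2 * α) • R x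
  rw [hT x, smul_add, smul_smul, smul_smul, sub_smul, one_smul, mul_sub, mul_one, sub_smul,
    two_smul]
  abel

/-- LEMMA 3.6: the resolvent `J_{cA}` of a `σ`-strongly monotone `A` (`c > 0`) is
`(1 + cσ)`-cocoercive (the source has `c = 1`; `cA` is `cσ`-strongly monotone, §4).
[cite: Giselsson2017, Lemma 3.6] -/
theorem isCocoercive_of_isStronglyMonotone {j : H → H} (hj : IsResolventMap c A j)
    (hA : IsStronglyMonotone σ A) (hc : 0 < c) : IsCocoercive (1 + c * σ) j := by
  intro z z'
  obtain ⟨u, hu, eu⟩ := hj.exists_mem z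
  obtain ⟨u', hu', eu'⟩ := hj.exists_mem z'
  have hsm := hA hu' hu
  have e : (j z + c • u) - (j z' + c • u') = z - z' := by rw [eu, eu']
  have e2 : (j z + c • u) - (j z' + c • u') = (j z - j z') + c • (u - u') := by
    rw [smul_sub]; abel
  rw [← e, e2, inner_add_smul_self]
  nlinarith [mul_le_mul_of_nonneg_left hsm hc.le]

/-! ## §3.2 Negatively averaged operators [Gis17, Def 3.7, Props 3.9, 3.10, 3.12] -/

/-- DEFINITION 3.7: `T` is `θ`-NEGATIVELY AVERAGED if `−T` is `θ`-averaged, i.e.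
`T = (θ − 1)Id + θR` with `R` nonexpansive. [cite: Giselsson2017, Def 3.7] -/
def IsNegAveraged (θ : ℝ) (T : H → H) : Prop := IsAveraged θ (fun x => -T x)

variable {T T₁ T₂ : H → H}

/-- Transport along an equality of constants. [cite: Giselsson2017, Def 3.7] -/
theorem IsNegAveraged.of_eq {θ' : ℝ} (h : IsNegAveraged θ T) (e : θ = θ') : IsNegAveraged θ' T :=
  e ▸ h

/-- A negatively averaged operator is nonexpansive ("since `−T` is averaged, it is also
nonexpansive, and so is `T`"; `θ ∈ [0, 1]`). [cite: Giselsson2017, Def 3.7] -/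
theorem IsNegAveraged.norm_sub_le (h : IsNegAveraged θ T) (hθ0 : 0 ≤ θ) (hθ1 : θ ≤ 1)
    (x y : H) : ‖T x - T y‖ ≤ ‖x - y‖ := by
  obtain ⟨R, hR, hT⟩ := h
  have e : T x - T y = -((1 - θ) • (x - y) + θ • (R x - R y)) := by
    have ex : T x = -((1 - θ) • x + θ • R x) := by rw [← hT x, neg_neg]
    have ey : T y = -((1 - θ) • y + θ • R y) := by rw [← hT y, neg_neg]
    rw [ex, ey, smul_sub, smul_sub]; abel
  rw [e, norm_neg]
  calc ‖(1 - θ) • (x - y) + θ • (R x - R y)‖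
      ≤ ‖(1 - θ) • (x - y)‖ + ‖θ • (R x - R y)‖ := norm_add_le _ _
    _ = (1 - θ) * ‖x - y‖ + θ * ‖R x - R y‖ := by
        rw [norm_smul, norm_smul, Real.norm_eq_abs, Real.norm_eq_abs,
          abs_of_nonneg (by linarith), abs_of_nonneg hθ0]
    _ ≤ (1 - θ) * ‖x - y‖ + θ * ‖x - y‖ := by
        have := mul_le_mul_of_nonneg_left (hR x y) hθ0
        linarith
    _ = ‖x - y‖ := by ring

/-- The characterisation (3.3): `T` is `θ`-negatively averaged (`θ > 0`) implies
`‖Tx − Ty‖² + (1 − θ)/θ ‖(Id + T)x − (Id + T)y‖² ≤ ‖x − y‖²`.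
[cite: Giselsson2017, §3.2 eq. (3.3)] -/
theorem IsNegAveraged.norm_sq_add_le (h : IsNegAveraged θ T) (hθ : 0 < θ) (x y : H) :
    ‖T x - T y‖ ^ 2 + (1 - θ) / θ * ‖(x + T x) - (y + T y)‖ ^ 2 ≤ ‖x - y‖ ^ 2 := by
  have b := IsAveraged.norm_sq_add_le h hθ x y
  have e1 : ‖(-T x) - (-T y)‖ = ‖T x - T y‖ := by
    rw [← norm_neg (T x - T y)]; congr 1; abel
  have e2 : (x - -T x) - (y - -T y) = (x + T x) - (y + T y) := by abel
  rw [e1, e2] at b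
  exact b

/-- Converse of (3.3): the inequality with `ν ≥ 0` gives `1/(1 + ν)`-negative averagedness.
[cite: Giselsson2017, §3.2 eq. (3.3)] -/
theorem isNegAveraged_of_norm_sq_add_le {ν : ℝ} (hν : 0 ≤ ν)
    (h : ∀ x y, ‖T x - T y‖ ^ 2 + ν * ‖(x + T x) - (y + T y)‖ ^ 2 ≤ ‖x - y‖ ^ 2) :
    IsNegAveraged (1 / (1 + ν)) T := by
  refine isAveraged_of_norm_sq_add_le hν fun x y => ?_
  have e1 : ‖(-T x) - (-T y)‖ = ‖T x - T y‖ := by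
    rw [← norm_neg (T x - T y)]; congr 1; abel
  have e2 : (x - -T x) - (y - -T y) = (x + T x) - (y + T y) := by abel
  show ‖(-T x) - (-T y)‖ ^ 2 + ν * ‖(x - -T x) - (y - -T y)‖ ^ 2 ≤ ‖x - y‖ ^ 2
  rw [e1, e2]
  exact h x y

/-- PROPOSITION 3.9: an `α`-averaged `θ`-negatively averaged operator
`S = (1 − α)Id + αT` (Def 3.8) is `(|1 − 2α + αθ| + αθ)`-Lipschitz (`α, θ ≥ 0`):
`S = (1 − 2α + αθ)Id − αθ R̄`. [cite: Giselsson2017, Prop 3.9] -/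
theorem IsNegAveraged.norm_averagedMap_sub_le (h : IsNegAveraged θ T) (hα : 0 ≤ α)
    (hθ : 0 ≤ θ) (x y : H) :
    ‖averagedMap T α x - averagedMap T α y‖ ≤ (|1 - 2 * α + α * θ| + α * θ) * ‖x - y‖ := by
  obtain ⟨R, hR, hT⟩ := h
  have ex : T x = -((1 - θ) • x + θ • R x) := by rw [← hT x, neg_neg]
  have ey : T y = -((1 - θ) • y + θ • R y) := by rw [← hT y, neg_neg]
  have e : averagedMap T α x - averagedMap T α y =
      (1 - 2 * α + α * θ) • (x - y) - (α * θ) • (R x - R y) := by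
    simp only [averagedMap]
    rw [ex, ey]
    module
  rw [e]
  calc ‖(1 - 2 * α + α * θ) • (x - y) - (α * θ) • (R x - R y)‖
      ≤ ‖(1 - 2 * α + α * θ) • (x - y)‖ + ‖(α * θ) • (R x - R y)‖ := _root_.norm_sub_le _ _
    _ = |1 - 2 * α + α * θ| * ‖x - y‖ + α * θ * ‖R x - R y‖ := by
        rw [norm_smul, norm_smul, Real.norm_eq_abs, Real.norm_eq_abs,
          abs_of_nonneg (mul_nonneg hα hθ)]
    _ ≤ |1 - 2 * α + α * θ| * ‖x - y‖ + α * θ * ‖x - y‖ := by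
        have := mul_le_mul_of_nonneg_left (hR x y) (mul_nonneg hα hθ)
        linarith
    _ = (|1 - 2 * α + α * θ| + α * θ) * ‖x - y‖ := by ring

/-- PROPOSITION 3.9 (contractive): for `α ∈ (0, 1)` and `θ < 1` (the source has `θ ∈ (0, 1)`)
the factor is `< 1`. [cite: Giselsson2017, Prop 3.9] -/
theorem negAvgRate_lt_one (hα0 : 0 < α) (hα1 : α < 1) (hθ1 : θ < 1) :
    |1 - 2 * α + α * θ| + α * θ < 1 := by
  rcases le_or_gt 0 (1 - 2 * α + α * θ) with h | h
  · rw [abs_of_nonneg h]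
    nlinarith [mul_pos hα0 (sub_pos.2 hθ1)]
  · rw [abs_of_neg h]
    linarith

/-- `0 ≤ |1 − 2α + αθ| + αθ` for `α, θ ≥ 0`. [cite: Giselsson2017, Prop 3.9] -/
theorem negAvgRate_nonneg (hα : 0 ≤ α) (hθ : 0 ≤ θ) : 0 ≤ |1 - 2 * α + α * θ| + α * θ :=
  add_nonneg (abs_nonneg _) (mul_nonneg hα hθ)

/-- PROPOSITION 3.10 (value at the kink): with `α = 1/(2 − θ)` the factor is `θ/(2 − θ)`.
[cite: Giselsson2017, Prop 3.10] -/
theorem negAvgRate_opt (hθ : θ < 2) :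
    |1 - 2 * (1 / (2 - θ)) + 1 / (2 - θ) * θ| + 1 / (2 - θ) * θ = θ / (2 - θ) := by
  have h2 : 2 - θ ≠ 0 := by intro h; linarith
  have e : 1 - 2 * (1 / (2 - θ)) + 1 / (2 - θ) * θ = 0 := by
    field_simp; ring
  rw [e, abs_zero, zero_add, one_div_mul_eq_div]

/-- PROPOSITION 3.10 (optimality): for `θ ≤ 1` (the source has `θ ∈ (0, 1)`, `α ∈ (0, 1)`;
only `θ ≤ 1` is needed) the factor is at least `θ/(2 − θ)` for every `α`.
[cite: Giselsson2017, Prop 3.10] -/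
theorem negAvgRate_ge_opt (hθ1 : θ ≤ 1) (α : ℝ) :
    θ / (2 - θ) ≤ |1 - 2 * α + α * θ| + α * θ := by
  have h2 : 0 < 2 - θ := by linarith
  rcases le_or_gt 0 (1 - 2 * α + α * θ) with h | h
  · rw [abs_of_nonneg h, div_le_iff₀ h2]
    have hk : α * (2 - θ) ≤ 1 := by linarith
    nlinarith [mul_le_mul_of_nonneg_left hk (sub_nonneg.2 hθ1)]
  · rw [abs_of_neg h, div_le_iff₀ h2]
    nlinarith

/-- PROPOSITION 3.12: if `T₁` is `θ`-negatively averaged and `T₂` is `α`-averaged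
(`θ, α ∈ (0, 1)`) then `T₁ ∘ T₂` is `κ/(κ + 1)`-negatively averaged with
`κ = θ/(1 − θ) + α/(1 − α)`. [cite: Giselsson2017, Prop 3.12] -/
theorem IsNegAveraged.comp (h₁ : IsNegAveraged θ T₁) (h₂ : IsAveraged α T₂) (hθ0 : 0 < θ)
    (hθ1 : θ < 1) (hα0 : 0 < α) (hα1 : α < 1) :
    IsNegAveraged ((θ / (1 - θ) + α / (1 - α)) / (θ / (1 - θ) + α / (1 - α) + 1))
      (T₁ ∘ T₂) := by
  set κ₁ := θ / (1 - θ) with hκ₁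
  set κ₂ := α / (1 - α) with hκ₂
  have hκ₁0 : 0 < κ₁ := div_pos hθ0 (by linarith)
  have hκ₂0 : 0 < κ₂ := div_pos hα0 (by linarith)
  have hκ0 : 0 < κ₁ + κ₂ := add_pos hκ₁0 hκ₂0
  have key : ∀ x y, ‖T₁ (T₂ x) - T₁ (T₂ y)‖ ^ 2 +
      (κ₁ + κ₂)⁻¹ * ‖(x + T₁ (T₂ x)) - (y + T₁ (T₂ y))‖ ^ 2 ≤ ‖x - y‖ ^ 2 := by
    intro x y
    have a := h₂.norm_sq_add_le hα0 x y
    have b := h₁.norm_sq_add_le hθ0 (T₂ x) (T₂ y)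
    have ea : (1 - α) / α = κ₂⁻¹ := by rw [hκ₂, inv_div]
    have eb : (1 - θ) / θ = κ₁⁻¹ := by rw [hκ₁, inv_div]
    rw [ea] at a
    rw [eb] at b
    have hp : ‖(x - T₂ x) - (y - T₂ y)‖ ^ 2 ≤ κ₂ * (‖x - y‖ ^ 2 - ‖T₂ x - T₂ y‖ ^ 2) :=
      (inv_mul_le_iff₀ hκ₂0).1 (by linarith)
    have hq : ‖(T₂ x + T₁ (T₂ x)) - (T₂ y + T₁ (T₂ y))‖ ^ 2 ≤
        κ₁ * (‖T₂ x - T₂ y‖ ^ 2 - ‖T₁ (T₂ x) - T₁ (T₂ y)‖ ^ 2) :=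
      (inv_mul_le_iff₀ hκ₁0).1 (by linarith)
    have hy := norm_add_sq_le_young ((x - T₂ x) - (y - T₂ y))
      ((T₂ x + T₁ (T₂ x)) - (T₂ y + T₁ (T₂ y))) (div_pos hκ₁0 hκ₂0)
    have epq : (x - T₂ x) - (y - T₂ y) + ((T₂ x + T₁ (T₂ x)) - (T₂ y + T₁ (T₂ y))) =
        (x + T₁ (T₂ x)) - (y + T₁ (T₂ y)) := by abel
    rw [epq, inv_div] at hy
    have e1 : (1 + κ₁ / κ₂) * κ₂ = κ₁ + κ₂ := by field_simp; ring
    have e2 : (1 + κ₂ / κ₁) * κ₁ = κ₁ + κ₂ := by field_simp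
    have h1 : (1 + κ₁ / κ₂) * ‖(x - T₂ x) - (y - T₂ y)‖ ^ 2 ≤
        (κ₁ + κ₂) * (‖x - y‖ ^ 2 - ‖T₂ x - T₂ y‖ ^ 2) := by
      calc (1 + κ₁ / κ₂) * ‖(x - T₂ x) - (y - T₂ y)‖ ^ 2
          ≤ (1 + κ₁ / κ₂) * (κ₂ * (‖x - y‖ ^ 2 - ‖T₂ x - T₂ y‖ ^ 2)) :=
            mul_le_mul_of_nonneg_left hp (by positivity)
        _ = (κ₁ + κ₂) * (‖x - y‖ ^ 2 - ‖T₂ x - T₂ y‖ ^ 2) := by rw [← mul_assoc, e1]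
    have h2 : (1 + κ₂ / κ₁) * ‖(T₂ x + T₁ (T₂ x)) - (T₂ y + T₁ (T₂ y))‖ ^ 2 ≤
        (κ₁ + κ₂) * (‖T₂ x - T₂ y‖ ^ 2 - ‖T₁ (T₂ x) - T₁ (T₂ y)‖ ^ 2) := by
      calc (1 + κ₂ / κ₁) * ‖(T₂ x + T₁ (T₂ x)) - (T₂ y + T₁ (T₂ y))‖ ^ 2
          ≤ (1 + κ₂ / κ₁) * (κ₁ * (‖T₂ x - T₂ y‖ ^ 2 - ‖T₁ (T₂ x) - T₁ (T₂ y)‖ ^ 2)) :=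
            mul_le_mul_of_nonneg_left hq (by positivity)
        _ = (κ₁ + κ₂) * (‖T₂ x - T₂ y‖ ^ 2 - ‖T₁ (T₂ x) - T₁ (T₂ y)‖ ^ 2) := by
            rw [← mul_assoc, e2]
    have hsum : ‖(x + T₁ (T₂ x)) - (y + T₁ (T₂ y))‖ ^ 2 ≤
        (κ₁ + κ₂) * (‖x - y‖ ^ 2 - ‖T₁ (T₂ x) - T₁ (T₂ y)‖ ^ 2) := by linarith
    have := (inv_mul_le_iff₀ hκ0).2 hsum
    linarith
  have hav := isNegAveraged_of_norm_sq_add_le (T := T₁ ∘ T₂) (inv_nonneg.2 hκ0.le)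
    (fun x y => by simpa only [Function.comp_apply] using key x y)
  refine hav.of_eq ?_
  have hne : κ₁ + κ₂ ≠ 0 := hκ0.ne'
  field_simp

/-! ## §4–§5: `A` strongly monotone and `B` cocoercive [Gis17, Props 5.2–5.5, Thm 5.6] -/

/-- PROPOSITION 5.2: the resolvent `J_{cB}` of a `1/β`-cocoercive single-valued `B = b`
(`β, c > 0`) is `cβ/(2(1 + cβ))`-averaged (source: `c = 1`).
[cite: Giselsson2017, Prop 5.2 (proof §10.1)] -/
theorem isAveraged_resolventMap_of_isCocoercive {b j : H → H} (hb : IsCocoercive (1 / β) b)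
    (hβ : 0 < β) (hj : IsResolventMap c (graph b) j) (hc : 0 < c) :
    IsAveraged (c * β / (2 * (1 + c * β))) j := by
  have hν : (0 : ℝ) ≤ (2 + c * β) / (c * β) := by positivity
  have h := isAveraged_of_norm_sq_add_le (T := j) hν (fun x y => by
    have ex : x - j x = c • b (j x) := (eq_sub_of_add_eq' (apply_add_smul_eq_of_graph hj x)).symm
    have ey : y - j y = c • b (j y) := (eq_sub_of_add_eq' (apply_add_smul_eq_of_graph hj y)).symm
    have hQ : ‖b (j x) - b (j y)‖ ^ 2 / β ≤ ⟪j x - j y, b (j x) - b (j y)⟫ := by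
      have := hb (j x) (j y); rwa [one_div_mul_eq_div] at this
    rw [ex, ey, ← smul_sub, sub_eq_of_graph hj x y, norm_add_smul_sq, norm_smul, mul_pow,
      Real.norm_eq_abs, sq_abs]
    have e : (2 + c * β) / (c * β) * (c ^ 2 * ‖b (j x) - b (j y)‖ ^ 2) =
        c ^ 2 * ‖b (j x) - b (j y)‖ ^ 2 + 2 * c * (‖b (j x) - b (j y)‖ ^ 2 / β) := by
      field_simp; ring
    rw [e]
    nlinarith [mul_le_mul_of_nonneg_left hQ (by positivity : (0 : ℝ) ≤ 2 * c)])
  refine h.of_eq ?_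
  field_simp
  ring

/-- PROPOSITION 5.3: the reflected resolvent `R_{cB} = 2J_{cB} − Id` of a `1/β`-cocoercive `b`
is `cβ/(1 + cβ)`-averaged. [cite: Giselsson2017, Prop 5.3] -/
theorem isAveraged_reflect_of_isCocoercive {b j : H → H} (hb : IsCocoercive (1 / β) b)
    (hβ : 0 < β) (hj : IsResolventMap c (graph b) j) (hc : 0 < c) :
    IsAveraged (c * β / (1 + c * β)) (fun z => (2 : ℝ) • j z - z) := by
  refine (isAveraged_two_smul_sub (isAveraged_resolventMap_of_isCocoercive hb hβ hj hc)).of_eq ?_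
  have : (1 + c * β) ≠ 0 := by positivity
  field_simp

/-- PROPOSITION 5.4: the reflected resolvent `R_{cA}` of a `σ`-strongly monotone `A`
(`σ ≥ 0`, `c > 0`) is `1/(1 + cσ)`-negatively averaged: `−R_{cA} = Id − 2J_{cA}` with `J_{cA}`
`(1 + cσ)`-cocoercive. [cite: Giselsson2017, Prop 5.4] -/
theorem isNegAveraged_reflect_of_isStronglyMonotone {j : H → H} (hj : IsResolventMap c A j)
    (hA : IsStronglyMonotone σ A) (hσ : 0 ≤ σ) (hc : 0 < c) :
    IsNegAveraged (1 / (1 + c * σ)) (fun z => (2 : ℝ) • j z - z) := by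
  have hco := isCocoercive_of_isStronglyMonotone hj hA hc
  have h := isAveraged_forwardStep_of_isCocoercive hco (by positivity) 2
  unfold IsNegAveraged
  simp only [neg_sub]
  refine h.of_eq ?_
  have : (1 + c * σ) ≠ 0 := by positivity
  field_simp

/-- The negative-averagedness constant `θ(c, σ, β) = (1/(cσ) + cβ)/(1/(cσ) + cβ + 1)` of
`R_{cA} R_{cB}`. [cite: Giselsson2017, Prop 5.5] -/
def negAvgConst (c σ β : ℝ) : ℝ := (1 / (c * σ) + c * β) / (1 / (c * σ) + c * β + 1)

/-- `0 < θ(c, σ, β) < 1` for `c, σ, β > 0`. [cite: Giselsson2017, Prop 5.5] -/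
theorem negAvgConst_pos (hc : 0 < c) (hσ : 0 < σ) (hβ : 0 < β) : 0 < negAvgConst c σ β := by
  unfold negAvgConst; positivity

/-- `θ(c, σ, β) < 1`. [cite: Giselsson2017, Prop 5.5] -/
theorem negAvgConst_lt_one (hc : 0 < c) (hσ : 0 < σ) (hβ : 0 < β) : negAvgConst c σ β < 1 := by
  unfold negAvgConst
  rw [div_lt_one (by positivity)]
  linarith

/-- `R_{cA} R_{cB}` is the composition of the two reflections. [cite: Giselsson2017, §4 eq. (4.3)] -/
theorem reflComp_eq_comp (ja jb : H → H) :
    reflComp ja jb = (fun z => (2 : ℝ) • ja z - z) ∘ (fun z => (2 : ℝ) • jb z - z) := by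
  funext z; rfl

/-- PROPOSITION 5.5: under Assumption 5.1 (`A` `σ`-strongly monotone, `B = b` `1/β`-cocoercive,
`σ, β, c > 0`) the composition `R_{cA} R_{cB}` is `θ(c, σ, β)`-negatively averaged.
[cite: Giselsson2017, Prop 5.5] -/
theorem isNegAveraged_reflComp {ja b jb : H → H} (hja : IsResolventMap c A ja)
    (hA : IsStronglyMonotone σ A) (hb : IsCocoercive (1 / β) b)
    (hjb : IsResolventMap c (graph b) jb) (hσ : 0 < σ) (hβ : 0 < β) (hc : 0 < c) :
    IsNegAveraged (negAvgConst c σ β) (reflComp ja jb) := by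
  have h1 := isNegAveraged_reflect_of_isStronglyMonotone hja hA hσ.le hc
  have h2 := isAveraged_reflect_of_isCocoercive hb hβ hjb hc
  have hcσ : 0 < c * σ := mul_pos hc hσ
  have hcβ : 0 < c * β := mul_pos hc hβ
  have h := h1.comp h2 (by positivity) (by rw [div_lt_one (by positivity)]; linarith)
    (by positivity) (by rw [div_lt_one (by positivity)]; linarith)
  rw [reflComp_eq_comp]
  refine h.of_eq ?_
  have e1 : 1 / (1 + c * σ) / (1 - 1 / (1 + c * σ)) = 1 / (c * σ) := by
    have : 1 + c * σ ≠ 0 := by positivity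
    field_simp
    ring
  have e2 : c * β / (1 + c * β) / (1 - c * β / (1 + c * β)) = c * β := by
    have : 1 + c * β ≠ 0 := by positivity
    field_simp
    ring
  rw [e1, e2, negAvgConst]

/-- THEOREM 5.6 (contraction factor): under Assumption 5.1 and `α ≥ 0` the relaxed
Douglas–Rachford map `(1 − α)Id + αR_{cA}R_{cB}` is Lipschitz with constant
`|1 − 2α + αθ| + αθ`, `θ = θ(c, σ, β)`. [cite: Giselsson2017, Thm 5.6] -/
theorem norm_kmStep_sub_le_of_sm_coco {ja b jb : H → H} (hja : IsResolventMap c A ja)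
    (hA : IsStronglyMonotone σ A) (hb : IsCocoercive (1 / β) b)
    (hjb : IsResolventMap c (graph b) jb) (hσ : 0 < σ) (hβ : 0 < β) (hc : 0 < c) (hα : 0 ≤ α)
    (x y : H) :
    ‖averagedMap (reflComp ja jb) α x - averagedMap (reflComp ja jb) α y‖ ≤
      (|1 - 2 * α + α * negAvgConst c σ β| + α * negAvgConst c σ β) * ‖x - y‖ :=
  (isNegAveraged_reflComp hja hA hb hjb hσ hβ hc).norm_averagedMap_sub_le hα
    (negAvgConst_pos hc hσ hβ).le x y

/-! ## §6: `A` strongly monotone and Lipschitz [Gis17, Prop 6.2, Thm 6.3, Prop 6.4, Thm 6.5] -/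

/-- PROPOSITION 6.2: for a `β`-Lipschitz single-valued `a` and its resolvent map `J = J_{ca}`,
`2⟨Jx − Jy, x − y⟩ ≥ ‖x − y‖² + (1 − (cβ)²)‖Jx − Jy‖²` (source: `c = 1`; only the Lipschitz
bound is used). [cite: Giselsson2017, Prop 6.2 (proof §11.1)] -/
theorem norm_sq_add_le_two_inner_of_lipschitz {a j : H → H}
    (ha : ∀ x y, ‖a x - a y‖ ≤ β * ‖x - y‖) (hj : IsResolventMap c (graph a) j) (x y : H) :
    ‖x - y‖ ^ 2 + (1 - (c * β) ^ 2) * ‖j x - j y‖ ^ 2 ≤ 2 * ⟪j x - j y, x - y⟫ := by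
  have hQ : ‖a (j x) - a (j y)‖ ^ 2 ≤ β ^ 2 * ‖j x - j y‖ ^ 2 := by
    rw [← mul_pow]
    exact pow_le_pow_left₀ (norm_nonneg _) (ha (j x) (j y)) 2
  rw [sub_eq_of_graph hj x y, real_inner_comm, inner_add_smul_self, norm_add_smul_sq]
  nlinarith [mul_le_mul_of_nonneg_left hQ (sq_nonneg c)]

/-- The contraction factor `δ(c, σ, β) = √(1 − 4cσ/(1 + 2cσ + (cβ)²))` of `R_{cA}` for `A`
`σ`-strongly monotone and `β`-Lipschitz. [cite: Giselsson2017, Thm 6.3] -/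
def lipContr (c σ β : ℝ) : ℝ := Real.sqrt (1 - 4 * c * σ / (1 + 2 * c * σ + (c * β) ^ 2))

/-- `0 ≤ δ(c, σ, β)`. [cite: Giselsson2017, Thm 6.3] -/
theorem lipContr_nonneg (c σ β : ℝ) : 0 ≤ lipContr c σ β := Real.sqrt_nonneg _

/-- `δ(c, σ, β) < 1` for `c, σ > 0`. [cite: Giselsson2017, Thm 6.3] -/
theorem lipContr_lt_one (hc : 0 < c) (hσ : 0 < σ) : lipContr c σ β < 1 := by
  unfold lipContr
  rw [Real.sqrt_lt' one_pos, one_pow]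
  have : 0 < 4 * c * σ / (1 + 2 * c * σ + (c * β) ^ 2) := by positivity
  linarith

/-- THEOREM 6.3: for a `σ`-strongly monotone, `β`-Lipschitz single-valued `a` (`σ ≥ 0`, `c ≥ 0`)
the reflected resolvent `R_{ca} = 2J_{ca} − Id` is `δ(c, σ, β)`-Lipschitz.  (Proof: with
`u = Jx − Jy`, `w = a(Jx) − a(Jy)`: `‖x − y‖² = ‖u‖² + 2c⟨u,w⟩ + c²‖w‖²`,
`‖Rx − Ry‖² = ‖u‖² − 2c⟨u,w⟩ + c²‖w‖²`, `⟨u,w⟩ ≥ σ‖u‖²`, `‖w‖ ≤ β‖u‖`.)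
[cite: Giselsson2017, Thm 6.3 (proof §11.2)] -/
theorem norm_reflect_sub_le_of_sm_lipschitz {a j : H → H} (hsm : IsStronglyMonotone σ (graph a))
    (ha : ∀ x y, ‖a x - a y‖ ≤ β * ‖x - y‖) (hj : IsResolventMap c (graph a) j) (hσ : 0 ≤ σ)
    (hc : 0 ≤ c) (x y : H) :
    ‖((2 : ℝ) • j x - x) - ((2 : ℝ) • j y - y)‖ ≤ lipContr c σ β * ‖x - y‖ := by
  apply norm_le_sqrt_mul
  set D := 1 + 2 * c * σ + (c * β) ^ 2 with hD
  have hD0 : 0 < D := by positivity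
  have hP : σ * ‖j x - j y‖ ^ 2 ≤ ⟪j x - j y, a (j x) - a (j y)⟫ :=
    isStronglyMonotone_graph_iff.1 hsm (j x) (j y)
  have hQ : ‖a (j x) - a (j y)‖ ^ 2 ≤ β ^ 2 * ‖j x - j y‖ ^ 2 := by
    rw [← mul_pow]
    exact pow_le_pow_left₀ (norm_nonneg _) (ha (j x) (j y)) 2
  have hP0 : 0 ≤ ⟪j x - j y, a (j x) - a (j y)⟫ :=
    (mul_nonneg hσ (sq_nonneg _)).trans hP
  rw [reflect_sub_eq_of_graph hj x y, norm_sub_smul_sq, sub_eq_of_graph hj x y, norm_add_smul_sq]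
  have key : σ * (‖j x - j y‖ ^ 2 + 2 * c * ⟪j x - j y, a (j x) - a (j y)⟫ +
      c ^ 2 * ‖a (j x) - a (j y)‖ ^ 2) ≤ ⟪j x - j y, a (j x) - a (j y)⟫ * D := by
    rw [hD]
    nlinarith [mul_le_mul_of_nonneg_left hQ (mul_nonneg hσ (sq_nonneg c)),
      mul_le_mul_of_nonneg_left hP (sq_nonneg (c * β))]
  have h1 : 4 * c * σ / D * (‖j x - j y‖ ^ 2 + 2 * c * ⟪j x - j y, a (j x) - a (j y)⟫ +
      c ^ 2 * ‖a (j x) - a (j y)‖ ^ 2) ≤ 4 * c * ⟪j x - j y, a (j x) - a (j y)⟫ := by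
    rw [div_mul_eq_mul_div, div_le_iff₀ hD0]
    nlinarith [mul_le_mul_of_nonneg_left key (by positivity : (0 : ℝ) ≤ 4 * c)]
  nlinarith [h1]

/-- PROPOSITION 6.4 (the value at `c = 1/β`): `δ(1/β, σ, β)² = (β − σ)/(β + σ)
= (β/σ − 1)/(β/σ + 1)` (`β > 0`, `σ ≥ 0`). [cite: Giselsson2017, Prop 6.4] -/
theorem lipContr_sq_at_inv (hβ : 0 < β) (hσ : 0 ≤ σ) :
    1 - 4 * (1 / β) * σ / (1 + 2 * (1 / β) * σ + (1 / β * β) ^ 2) = (β - σ) / (β + σ) := by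
  have hβ' : β ≠ 0 := hβ.ne'
  have : β + σ ≠ 0 := by positivity
  field_simp
  ring

/-- PROPOSITION 6.4 (optimality of `c = 1/β`): for every `c ≥ 0`,
`(β − σ)/(β + σ) ≤ δ(c, σ, β)²`, since the difference is `2σ(1 − cβ)²/((1 + 2cσ + c²β²)(β + σ))`.
[cite: Giselsson2017, Prop 6.4] -/
theorem lipContr_sq_opt_le (hβ : 0 < β) (hσ : 0 ≤ σ) (hc : 0 ≤ c) :
    (β - σ) / (β + σ) ≤ 1 - 4 * c * σ / (1 + 2 * c * σ + (c * β) ^ 2) := by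
  have hD : (0 : ℝ) < 1 + 2 * c * σ + (c * β) ^ 2 := by positivity
  have hs : 0 < β + σ := by positivity
  rw [← sub_nonneg]
  have e : 1 - 4 * c * σ / (1 + 2 * c * σ + (c * β) ^ 2) - (β - σ) / (β + σ) =
      2 * σ * (1 - c * β) ^ 2 / ((1 + 2 * c * σ + (c * β) ^ 2) * (β + σ)) := by
    field_simp
    ring
  rw [e]
  positivity

/-- PROPOSITION 6.4 (as constants): `δ(1/β, σ, β) ≤ δ(c, σ, β)` for all `c ≥ 0`.
[cite: Giselsson2017, Prop 6.4] -/
theorem lipContr_at_inv_le (hβ : 0 < β) (hσ : 0 ≤ σ) (hc : 0 ≤ c) :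
    lipContr (1 / β) σ β ≤ lipContr c σ β := by
  unfold lipContr
  rw [lipContr_sq_at_inv hβ hσ]
  exact Real.sqrt_le_sqrt (lipContr_sq_opt_le hβ hσ hc)

/-- THEOREM 6.5 (the composition): `R_{cA} R_{cB}` is `δ(c, σ, β)`-Lipschitz when `A = graph a`
with `a` `σ`-strongly monotone and `β`-Lipschitz and `B` monotone (`c > 0`).
[cite: Giselsson2017, Thm 6.5] -/
theorem norm_reflComp_sub_le_of_sm_lipschitz {a ja jb : H → H}
    (hsm : IsStronglyMonotone σ (graph a)) (ha : ∀ x y, ‖a x - a y‖ ≤ β * ‖x - y‖)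
    (hja : IsResolventMap c (graph a) ja) (hjb : IsResolventMap c B jb) (hB : IsMonotone B)
    (hσ : 0 ≤ σ) (hc : 0 < c) (x y : H) :
    ‖reflComp ja jb x - reflComp ja jb y‖ ≤ lipContr c σ β * ‖x - y‖ := by
  calc ‖reflComp ja jb x - reflComp ja jb y‖
      ≤ lipContr c σ β * ‖((2 : ℝ) • jb x - x) - ((2 : ℝ) • jb y - y)‖ :=
        norm_reflect_sub_le_of_sm_lipschitz hsm ha hja hσ hc.le _ _
    _ ≤ lipContr c σ β * ‖x - y‖ :=
        mul_le_mul_of_nonneg_left (hjb.norm_reflect_sub_le hB hc y x) (lipContr_nonneg _ _ _)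

/-- THEOREM 6.5 (the composition, other order): `R_{cB} R_{cA}` is `δ(c, σ, β)`-Lipschitz too.
[cite: Giselsson2017, Thm 6.5] -/
theorem norm_reflComp_sub_le_of_sm_lipschitz' {a ja jb : H → H}
    (hsm : IsStronglyMonotone σ (graph a)) (ha : ∀ x y, ‖a x - a y‖ ≤ β * ‖x - y‖)
    (hja : IsResolventMap c (graph a) ja) (hjb : IsResolventMap c B jb) (hB : IsMonotone B)
    (hσ : 0 ≤ σ) (hc : 0 < c) (x y : H) :
    ‖reflComp jb ja x - reflComp jb ja y‖ ≤ lipContr c σ β * ‖x - y‖ := by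
  calc ‖reflComp jb ja x - reflComp jb ja y‖
      ≤ ‖((2 : ℝ) • ja x - x) - ((2 : ℝ) • ja y - y)‖ := hjb.norm_reflect_sub_le hB hc _ _
    _ ≤ lipContr c σ β * ‖x - y‖ := norm_reflect_sub_le_of_sm_lipschitz hsm ha hja hσ hc.le x y

/-- THEOREM 6.5 (rate factor): the relaxed Douglas–Rachford map is
`(|1 − α| + αδ)`-Lipschitz, `δ = δ(c, σ, β)`, for `α ≥ 0`. [cite: Giselsson2017, Thm 6.5] -/
theorem norm_kmStep_sub_le_of_sm_lipschitz {a ja jb : H → H}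
    (hsm : IsStronglyMonotone σ (graph a)) (ha : ∀ x y, ‖a x - a y‖ ≤ β * ‖x - y‖)
    (hja : IsResolventMap c (graph a) ja) (hjb : IsResolventMap c B jb) (hB : IsMonotone B)
    (hσ : 0 ≤ σ) (hc : 0 < c) (hα : 0 ≤ α) (x y : H) :
    ‖averagedMap (reflComp ja jb) α x - averagedMap (reflComp ja jb) α y‖ ≤
      (|1 - α| + α * lipContr c σ β) * ‖x - y‖ :=
  norm_averagedMap_sub_le_of_lipschitz
    (norm_reflComp_sub_le_of_sm_lipschitz hsm ha hja hjb hB hσ hc) hα x y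

/-! ## §7: `A` strongly monotone and cocoercive [Gis17, Thm 7.2, Prop 7.3, Thm 7.4] -/

/-- The contraction factor `δ'(c, σ, β) = √(1 − 4cσ/(1 + 2cσ + c²σβ))` of `R_{cA}` for `A`
`σ`-strongly monotone and `1/β`-cocoercive. [cite: Giselsson2017, Thm 7.2] -/
def cocoContr (c σ β : ℝ) : ℝ := Real.sqrt (1 - 4 * c * σ / (1 + 2 * c * σ + c ^ 2 * (σ * β)))

/-- `0 ≤ δ'(c, σ, β)`. [cite: Giselsson2017, Thm 7.2] -/
theorem cocoContr_nonneg (c σ β : ℝ) : 0 ≤ cocoContr c σ β := Real.sqrt_nonneg _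

/-- `δ'(c, σ, β) < 1` for `c, σ > 0`, `β ≥ 0`. [cite: Giselsson2017, Thm 7.2] -/
theorem cocoContr_lt_one (hc : 0 < c) (hσ : 0 < σ) (hβ : 0 ≤ β) : cocoContr c σ β < 1 := by
  unfold cocoContr
  rw [Real.sqrt_lt' one_pos, one_pow]
  have : 0 < 4 * c * σ / (1 + 2 * c * σ + c ^ 2 * (σ * β)) := by positivity
  linarith

/-- THEOREM 7.2: for a `σ`-strongly monotone, `1/β`-cocoercive single-valued `a`
(`σ ≥ 0`, `β > 0`, `c ≥ 0`) the reflected resolvent `R_{ca}` is `δ'(c, σ, β)`-Lipschitz.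
(Proof as for Thm 6.3 with `‖w‖² ≤ β⟨u, w⟩` in place of `‖w‖ ≤ β‖u‖`.)
[cite: Giselsson2017, Thm 7.2 (proof §12.1)] -/
theorem norm_reflect_sub_le_of_sm_coco {a j : H → H} (hsm : IsStronglyMonotone σ (graph a))
    (ha : IsCocoercive (1 / β) a) (hj : IsResolventMap c (graph a) j) (hσ : 0 ≤ σ) (hβ : 0 < β)
    (hc : 0 ≤ c) (x y : H) :
    ‖((2 : ℝ) • j x - x) - ((2 : ℝ) • j y - y)‖ ≤ cocoContr c σ β * ‖x - y‖ := by
  apply norm_le_sqrt_mul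
  set D := 1 + 2 * c * σ + c ^ 2 * (σ * β) with hD
  have hD0 : 0 < D := by positivity
  have hP : σ * ‖j x - j y‖ ^ 2 ≤ ⟪j x - j y, a (j x) - a (j y)⟫ :=
    isStronglyMonotone_graph_iff.1 hsm (j x) (j y)
  have hQ : ‖a (j x) - a (j y)‖ ^ 2 ≤ β * ⟪j x - j y, a (j x) - a (j y)⟫ := by
    have := ha (j x) (j y)
    rw [one_div_mul_eq_div, div_le_iff₀ hβ] at this
    linarith
  rw [reflect_sub_eq_of_graph hj x y, norm_sub_smul_sq, sub_eq_of_graph hj x y, norm_add_smul_sq]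
  have key : σ * (‖j x - j y‖ ^ 2 + 2 * c * ⟪j x - j y, a (j x) - a (j y)⟫ +
      c ^ 2 * ‖a (j x) - a (j y)‖ ^ 2) ≤ ⟪j x - j y, a (j x) - a (j y)⟫ * D := by
    rw [hD]
    nlinarith [mul_le_mul_of_nonneg_left hQ (mul_nonneg hσ (sq_nonneg c))]
  have h1 : 4 * c * σ / D * (‖j x - j y‖ ^ 2 + 2 * c * ⟪j x - j y, a (j x) - a (j y)⟫ +
      c ^ 2 * ‖a (j x) - a (j y)‖ ^ 2) ≤ 4 * c * ⟪j x - j y, a (j x) - a (j y)⟫ := by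
    rw [div_mul_eq_mul_div, div_le_iff₀ hD0]
    nlinarith [mul_le_mul_of_nonneg_left key (by positivity : (0 : ℝ) ≤ 4 * c)]
  nlinarith [h1]

/-- PROPOSITION 7.3 (the value at `c = 1/√(σβ)`): with `s = √(σβ)` (`σ, β > 0`),
`δ'(1/s, σ, β)² = (s − σ)/(s + σ) = (√(β/σ) − 1)/(√(β/σ) + 1)`.
[cite: Giselsson2017, Prop 7.3] -/
theorem cocoContr_sq_at_invSqrt (hσ : 0 < σ) (hβ : 0 < β) :
    1 - 4 * (1 / Real.sqrt (σ * β)) * σ /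
        (1 + 2 * (1 / Real.sqrt (σ * β)) * σ + (1 / Real.sqrt (σ * β)) ^ 2 * (σ * β)) =
      (Real.sqrt (σ * β) - σ) / (Real.sqrt (σ * β) + σ) := by
  set s := Real.sqrt (σ * β) with hs
  have hs0 : 0 < s := Real.sqrt_pos.2 (mul_pos hσ hβ)
  have hs2 : s ^ 2 = σ * β := Real.sq_sqrt (mul_pos hσ hβ).le
  rw [← hs2]
  have hs' : s ≠ 0 := hs0.ne'
  have : s + σ ≠ 0 := by positivity
  field_simp
  ring

/-- PROPOSITION 7.3 (optimality of `c = 1/√(σβ)`): for every `c ≥ 0`,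
`(√(σβ) − σ)/(√(σβ) + σ) ≤ δ'(c, σ, β)²`, the difference being
`2σ(1 − c√(σβ))²/((1 + 2cσ + c²σβ)(√(σβ) + σ))`. [cite: Giselsson2017, Prop 7.3] -/
theorem cocoContr_sq_opt_le (hσ : 0 < σ) (hβ : 0 < β) (hc : 0 ≤ c) :
    (Real.sqrt (σ * β) - σ) / (Real.sqrt (σ * β) + σ) ≤
      1 - 4 * c * σ / (1 + 2 * c * σ + c ^ 2 * (σ * β)) := by
  set s := Real.sqrt (σ * β) with hs
  have hs0 : 0 < s := Real.sqrt_pos.2 (mul_pos hσ hβ)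
  have hs2 : s ^ 2 = σ * β := Real.sq_sqrt (mul_pos hσ hβ).le
  rw [← hs2]
  have hD : (0 : ℝ) < 1 + 2 * c * σ + c ^ 2 * s ^ 2 := by positivity
  have hsσ : 0 < s + σ := by positivity
  rw [← sub_nonneg]
  have e : 1 - 4 * c * σ / (1 + 2 * c * σ + c ^ 2 * s ^ 2) - (s - σ) / (s + σ) =
      2 * σ * (1 - c * s) ^ 2 / ((1 + 2 * c * σ + c ^ 2 * s ^ 2) * (s + σ)) := by
    field_simp
    ring
  rw [e]
  positivity

/-- PROPOSITION 7.3 (as constants): `δ'(1/√(σβ), σ, β) ≤ δ'(c, σ, β)` for all `c ≥ 0`.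
[cite: Giselsson2017, Prop 7.3] -/
theorem cocoContr_at_invSqrt_le (hσ : 0 < σ) (hβ : 0 < β) (hc : 0 ≤ c) :
    cocoContr (1 / Real.sqrt (σ * β)) σ β ≤ cocoContr c σ β := by
  unfold cocoContr
  rw [cocoContr_sq_at_invSqrt hσ hβ]
  exact Real.sqrt_le_sqrt (cocoContr_sq_opt_le hσ hβ hc)

/-- THEOREM 7.4 (the composition): `R_{cA} R_{cB}` is `δ'(c, σ, β)`-Lipschitz when
`A = graph a` with `a` `σ`-strongly monotone and `1/β`-cocoercive and `B` monotone (`c > 0`).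
[cite: Giselsson2017, Thm 7.4] -/
theorem norm_reflComp_sub_le_of_sm_coco {a ja jb : H → H}
    (hsm : IsStronglyMonotone σ (graph a)) (ha : IsCocoercive (1 / β) a)
    (hja : IsResolventMap c (graph a) ja) (hjb : IsResolventMap c B jb) (hB : IsMonotone B)
    (hσ : 0 ≤ σ) (hβ : 0 < β) (hc : 0 < c) (x y : H) :
    ‖reflComp ja jb x - reflComp ja jb y‖ ≤ cocoContr c σ β * ‖x - y‖ := by
  calc ‖reflComp ja jb x - reflComp ja jb y‖
      ≤ cocoContr c σ β * ‖((2 : ℝ) • jb x - x) - ((2 : ℝ) • jb y - y)‖ :=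
        norm_reflect_sub_le_of_sm_coco hsm ha hja hσ hβ hc.le _ _
    _ ≤ cocoContr c σ β * ‖x - y‖ :=
        mul_le_mul_of_nonneg_left (hjb.norm_reflect_sub_le hB hc y x) (cocoContr_nonneg _ _ _)

/-- THEOREM 7.4 (rate factor): the relaxed Douglas–Rachford map is
`(|1 − α| + αδ')`-Lipschitz, `δ' = δ'(c, σ, β)`, for `α ≥ 0`. [cite: Giselsson2017, Thm 7.4] -/
theorem norm_kmStep_sub_le_of_sm_coco_same {a ja jb : H → H}
    (hsm : IsStronglyMonotone σ (graph a)) (ha : IsCocoercive (1 / β) a)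
    (hja : IsResolventMap c (graph a) ja) (hjb : IsResolventMap c B jb) (hB : IsMonotone B)
    (hσ : 0 ≤ σ) (hβ : 0 < β) (hc : 0 < c) (hα : 0 ≤ α) (x y : H) :
    ‖averagedMap (reflComp ja jb) α x - averagedMap (reflComp ja jb) α y‖ ≤
      (|1 - α| + α * cocoContr c σ β) * ‖x - y‖ :=
  norm_averagedMap_sub_le_of_lipschitz
    (norm_reflComp_sub_le_of_sm_coco hsm ha hja hjb hB hσ hβ hc) hα x y

/-! ## "Converges at least with rate factor `ρ`" [Gis17, §4; Berinde2007, Ch. 2, Thm 2.1 (Banach)] -/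

omit [InnerProductSpace ℝ H] in
/-- A `ρ`-Lipschitz map with `0 ≤ ρ < 1` on a (nonempty) complete space has a fixed point
(Banach's fixed point theorem, existence half of (i)). [cite: Berinde2007, Ch. 2, Thm 2.1 (i)] -/
theorem exists_fixedPoint_of_contractive [CompleteSpace H] {ρ : ℝ} (hρ0 : 0 ≤ ρ) (hρ1 : ρ < 1)
    (hT : ∀ x y, ‖T x - T y‖ ≤ ρ * ‖x - y‖) (x₀ : H) : ∃ p, T p = p := by
  haveI : Nonempty H := ⟨x₀⟩
  have hK : ContractingWith (Real.toNNReal ρ) T := by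
    refine ⟨?_, LipschitzWith.of_dist_le_mul fun x y => ?_⟩
    · exact_mod_cast (Real.toNNReal_lt_toNNReal_iff_of_nonneg hρ0).2 hρ1 |>.trans_eq
        Real.toNNReal_one
    · rw [dist_eq_norm, dist_eq_norm, Real.coe_toNNReal ρ hρ0]
      exact hT x y
  exact ⟨ContractingWith.fixedPoint T hK, hK.fixedPoint_isFixedPt⟩

omit [InnerProductSpace ℝ H] in
/-- The fixed point of a `ρ`-Lipschitz map with `ρ < 1` is unique ("card F_T ≤ 1").
[cite: Berinde2007, Ch. 2, Thm 2.1 (i)] -/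
theorem fixedPoint_unique_of_contractive {ρ : ℝ} (hρ1 : ρ < 1)
    (hT : ∀ x y, ‖T x - T y‖ ≤ ρ * ‖x - y‖) {p q : H} (hp : T p = p) (hq : T q = q) :
    p = q := by
  have h := hT p q
  rw [hp, hq] at h
  have h0 : ‖p - q‖ = 0 := by
    by_contra hne
    have hpos : 0 < ‖p - q‖ := lt_of_le_of_ne (norm_nonneg _) (Ne.symm hne)
    nlinarith
  exact sub_eq_zero.1 (norm_eq_zero.1 h0)

omit [InnerProductSpace ℝ H] in
/-- LINEAR RATE ("the rate of convergence is given by `d(x_n, x*) ≤ aⁿ d(x_0, x*)`"): if `T`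
is `ρ`-Lipschitz (`ρ ≥ 0`) with fixed point `p` then `‖Tⁿ x − p‖ ≤ ρⁿ ‖x − p‖`.
[cite: Berinde2007, Ch. 2, Thm 2.1 (iv) eq. (5)] -/
theorem norm_iterate_sub_le_of_contractive {ρ : ℝ} (hρ0 : 0 ≤ ρ)
    (hT : ∀ x y, ‖T x - T y‖ ≤ ρ * ‖x - y‖) {p : H} (hp : T p = p) (x : H) (n : ℕ) :
    ‖T^[n] x - p‖ ≤ ρ ^ n * ‖x - p‖ := by
  induction n with
  | zero => simp
  | succ n ih =>
    rw [Function.iterate_succ_apply', pow_succ]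
    calc ‖T (T^[n] x) - p‖ = ‖T (T^[n] x) - T p‖ := by rw [hp]
      _ ≤ ρ * ‖T^[n] x - p‖ := hT _ _
      _ ≤ ρ * (ρ ^ n * ‖x - p‖) := mul_le_mul_of_nonneg_left ih hρ0
      _ = ρ ^ n * ρ * ‖x - p‖ := by ring

omit [InnerProductSpace ℝ H] in
/-- Hence the Picard iterates converge (in norm) to the fixed point when `0 ≤ ρ < 1`.
[cite: Berinde2007, Ch. 2, Thm 2.1 (ii)] -/
theorem tendsto_iterate_of_contractive {ρ : ℝ} (hρ0 : 0 ≤ ρ) (hρ1 : ρ < 1)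
    (hT : ∀ x y, ‖T x - T y‖ ≤ ρ * ‖x - y‖) {p : H} (hp : T p = p) (x : H) :
    Tendsto (fun n => T^[n] x) atTop (𝓝 p) := by
  rw [tendsto_iff_norm_sub_tendsto_zero]
  refine squeeze_zero (fun n => norm_nonneg _)
    (fun n => norm_iterate_sub_le_of_contractive hρ0 hT hp x n) ?_
  simpa using (tendsto_pow_atTop_nhds_zero_of_lt_one hρ0 hρ1).mul_const ‖x - p‖

/-- The common conclusion of Theorems 5.6, 6.5, 7.4: if the relaxed Douglas–Rachford map
`S = (1 − α)Id + αR_{cA}R_{cB}` (`α ≠ 0`, `c > 0`, `A`, `B` monotone with resolvent maps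
`ja`, `jb`) is `ρ`-Lipschitz with `0 ≤ ρ < 1`, then there is `z̄` with `S z̄ = z̄`, `z̄` is a fixed
point of the Douglas–Rachford step, `x̄ = J_{cB} z̄ ∈ zer(A + B)`, and for every `z₀`:
`‖z^n − z̄‖ ≤ ρⁿ‖z₀ − z̄‖` and `‖J_{cB} z^n − x̄‖ ≤ ρⁿ‖z₀ − z̄‖`.
[cite: Giselsson2017, §4 and Thms 5.6, 6.5, 7.4] -/
theorem linearRate_of_contractive [CompleteSpace H] {ja jb : H → H} {ρ : ℝ}
    (hja : IsResolventMap c A ja) (hjb : IsResolventMap c B jb) (hA : IsMonotone A)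
    (hB : IsMonotone B) (hc : 0 < c) (hα : α ≠ 0) (hρ0 : 0 ≤ ρ) (hρ1 : ρ < 1)
    (hS : ∀ x y, ‖averagedMap (reflComp ja jb) α x - averagedMap (reflComp ja jb) α y‖ ≤
      ρ * ‖x - y‖) (z₀ : H) :
    ∃ z, averagedMap (reflComp ja jb) α z = z ∧ drStep ja jb z = z ∧
      jb z ∈ zer (opSum A B) ∧
      (∀ n, ‖kmIter (reflComp ja jb) α z₀ n - z‖ ≤ ρ ^ n * ‖z₀ - z‖) ∧
      (∀ n, ‖jb (kmIter (reflComp ja jb) α z₀ n) - jb z‖ ≤ ρ ^ n * ‖z₀ - z‖) ∧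
      Tendsto (kmIter (reflComp ja jb) α z₀) atTop (𝓝 z) := by
  obtain ⟨z, hz⟩ := exists_fixedPoint_of_contractive hρ0 hρ1 hS z₀
  have hdr : drStep ja jb z = z :=
    (reflComp_eq_self_iff ja jb).1 ((averagedMap_eq_self_iff hα).1 hz)
  refine ⟨z, hz, hdr, apply_mem_zer_opSum_of_drStep_eq_self hja hjb hA hB hc hdr,
    fun n => norm_iterate_sub_le_of_contractive hρ0 hS hz z₀ n, fun n => ?_,
    tendsto_iterate_of_contractive hρ0 hρ1 hS hz z₀⟩
  exact (hjb.norm_sub_le hB hc z _).trans (norm_iterate_sub_le_of_contractive hρ0 hS hz z₀ n)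

/-- THEOREM 5.6: under Assumption 5.1 (`A` `σ`-strongly monotone with resolvent map `ja`,
`B = graph b` with `b` `1/β`-cocoercive and resolvent map `jb`; `σ, β, c > 0`) and
`α ∈ (0, 1)`, the relaxed Douglas–Rachford iteration converges linearly with rate factor
`|1 − 2α + αθ| + αθ`, `θ = θ(c, σ, β)`, to the unique fixed point `z̄`, and
`J_{cB} z^n → J_{cB} z̄`, the unique zero of `A + B`, at the same rate.
[cite: Giselsson2017, Thm 5.6] -/
theorem linearRate_of_sm_coco [CompleteSpace H] {ja b jb : H → H}
    (hja : IsResolventMap c A ja) (hA : IsStronglyMonotone σ A) (hb : IsCocoercive (1 / β) b)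
    (hjb : IsResolventMap c (graph b) jb) (hσ : 0 < σ) (hβ : 0 < β) (hc : 0 < c)
    (hα0 : 0 < α) (hα1 : α < 1) (z₀ : H) :
    ∃ z, averagedMap (reflComp ja jb) α z = z ∧ drStep ja jb z = z ∧
      zer (opSum A (graph b)) = {jb z} ∧
      (∀ n, ‖kmIter (reflComp ja jb) α z₀ n - z‖ ≤
        (|1 - 2 * α + α * negAvgConst c σ β| + α * negAvgConst c σ β) ^ n * ‖z₀ - z‖) ∧
      (∀ n, ‖jb (kmIter (reflComp ja jb) α z₀ n) - jb z‖ ≤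
        (|1 - 2 * α + α * negAvgConst c σ β| + α * negAvgConst c σ β) ^ n * ‖z₀ - z‖) ∧
      Tendsto (kmIter (reflComp ja jb) α z₀) atTop (𝓝 z) := by
  have hbm : IsMonotone (graph b) := by
    intro x u hxu y v hyv
    rw [mem_graph_iff] at hxu hyv
    rw [hxu, hyv]
    exact (mul_nonneg (by positivity : (0 : ℝ) ≤ 1 / β) (sq_nonneg _)).trans (hb y x)
  obtain ⟨z, hz, hdr, hmem, h1, h2, h3⟩ := linearRate_of_contractive hja hjb (hA.isMonotone hσ.le)
    hbm hc hα0.ne' (negAvgRate_nonneg hα0.le (negAvgConst_pos hc hσ hβ).le)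
    (negAvgRate_lt_one hα0 hα1 (negAvgConst_lt_one hc hσ hβ))
    (norm_kmStep_sub_le_of_sm_coco hja hA hb hjb hσ hβ hc hα0.le) z₀
  exact ⟨z, hz, hdr, Set.eq_singleton_iff_unique_mem.2
    ⟨hmem, fun x hx => hA.subsingleton_zer_opSum hσ hbm hx hmem⟩, h1, h2, h3⟩

/-- THEOREM 6.5: under Assumption 6.1 (`A = graph a`, `a` `σ`-strongly monotone and
`β`-Lipschitz, `B` monotone, resolvent maps `ja`, `jb`; `σ, c > 0`) and
`α ∈ (0, 2/(1 + δ))`, `δ = δ(c, σ, β)`, the relaxed Douglas–Rachford iteration converges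
linearly with rate factor `|1 − α| + αδ`; `J_{cB} z^n → J_{cB} z̄`, the unique zero of `A + B`.
[cite: Giselsson2017, Thm 6.5] -/
theorem linearRate_of_sm_lipschitz [CompleteSpace H] {a ja jb : H → H}
    (hsm : IsStronglyMonotone σ (graph a)) (ha : ∀ x y, ‖a x - a y‖ ≤ β * ‖x - y‖)
    (hja : IsResolventMap c (graph a) ja) (hjb : IsResolventMap c B jb) (hB : IsMonotone B)
    (hσ : 0 < σ) (hc : 0 < c) (hα0 : 0 < α) (hα : α < 2 / (1 + lipContr c σ β)) (z₀ : H) :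
    ∃ z, averagedMap (reflComp ja jb) α z = z ∧ drStep ja jb z = z ∧
      zer (opSum (graph a) B) = {jb z} ∧
      (∀ n, ‖kmIter (reflComp ja jb) α z₀ n - z‖ ≤
        (|1 - α| + α * lipContr c σ β) ^ n * ‖z₀ - z‖) ∧
      (∀ n, ‖jb (kmIter (reflComp ja jb) α z₀ n) - jb z‖ ≤
        (|1 - α| + α * lipContr c σ β) ^ n * ‖z₀ - z‖) ∧
      Tendsto (kmIter (reflComp ja jb) α z₀) atTop (𝓝 z) := by
  obtain ⟨z, hz, hdr, hmem, h1, h2, h3⟩ := linearRate_of_contractive hja hjb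
    (hsm.isMonotone hσ.le) hB hc hα0.ne'
    (rate_nonneg_of_contractive (lipContr_nonneg c σ β) hα0.le)
    (rate_lt_one_of_contractive (lipContr_nonneg c σ β) (lipContr_lt_one hc hσ) hα0 hα)
    (norm_kmStep_sub_le_of_sm_lipschitz hsm ha hja hjb hB hσ.le hc hα0.le) z₀
  exact ⟨z, hz, hdr, Set.eq_singleton_iff_unique_mem.2
    ⟨hmem, fun x hx => hsm.subsingleton_zer_opSum hσ hB hx hmem⟩, h1, h2, h3⟩

/-- THEOREM 6.5 for the classical Douglas–Rachford iteration (`α = 1/2`): rate factor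
`(1 + δ)/2`. [cite: Giselsson2017, Thm 6.5 (α = 1/2, "traditionally called Douglas–Rachford", §4)] -/
theorem linearRate_drIter_of_sm_lipschitz [CompleteSpace H] {a ja jb : H → H}
    (hsm : IsStronglyMonotone σ (graph a)) (ha : ∀ x y, ‖a x - a y‖ ≤ β * ‖x - y‖)
    (hja : IsResolventMap c (graph a) ja) (hjb : IsResolventMap c B jb) (hB : IsMonotone B)
    (hσ : 0 < σ) (hc : 0 < c) (z₀ : H) :
    ∃ z, drStep ja jb z = z ∧ zer (opSum (graph a) B) = {jb z} ∧
      (∀ n, ‖drIter ja jb z₀ n - z‖ ≤ ((1 + lipContr c σ β) / 2) ^ n * ‖z₀ - z‖) ∧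
      (∀ n, ‖jb (drIter ja jb z₀ n) - jb z‖ ≤ ((1 + lipContr c σ β) / 2) ^ n * ‖z₀ - z‖) ∧
      Tendsto (drIter ja jb z₀) atTop (𝓝 z) := by
  have hδ1 := lipContr_lt_one (β := β) hc hσ
  have hδ0 := lipContr_nonneg c σ β
  have hα : (1 / 2 : ℝ) < 2 / (1 + lipContr c σ β) := by
    rw [lt_div_iff₀ (by linarith)]; linarith
  obtain ⟨z, -, hdr, hzer, h1, h2, h3⟩ :=
    linearRate_of_sm_lipschitz hsm ha hja hjb hB hσ hc (by norm_num) hα z₀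
  have e : |1 - (1 / 2 : ℝ)| + 1 / 2 * lipContr c σ β = (1 + lipContr c σ β) / 2 := by
    rw [show (1 - (1 / 2 : ℝ)) = 1 / 2 by norm_num, abs_of_pos (by norm_num : (0 : ℝ) < 1 / 2)]
    ring
  rw [e] at h1 h2
  rw [drIter_eq_kmIter]
  exact ⟨z, hdr, hzer, h1, h2, h3⟩

/-- THEOREM 7.4: under Assumption 7.1 (`A = graph a`, `a` `σ`-strongly monotone and
`1/β`-cocoercive, `B` monotone; `σ, β, c > 0`) and `α ∈ (0, 2/(1 + δ'))`, `δ' = δ'(c, σ, β)`,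
the relaxed Douglas–Rachford iteration converges linearly with rate factor `|1 − α| + αδ'`;
`J_{cB} z^n → J_{cB} z̄`, the unique zero of `A + B`. [cite: Giselsson2017, Thm 7.4] -/
theorem linearRate_of_sm_coco_same [CompleteSpace H] {a ja jb : H → H}
    (hsm : IsStronglyMonotone σ (graph a)) (ha : IsCocoercive (1 / β) a)
    (hja : IsResolventMap c (graph a) ja) (hjb : IsResolventMap c B jb) (hB : IsMonotone B)
    (hσ : 0 < σ) (hβ : 0 < β) (hc : 0 < c) (hα0 : 0 < α) (hα : α < 2 / (1 + cocoContr c σ β))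
    (z₀ : H) :
    ∃ z, averagedMap (reflComp ja jb) α z = z ∧ drStep ja jb z = z ∧
      zer (opSum (graph a) B) = {jb z} ∧
      (∀ n, ‖kmIter (reflComp ja jb) α z₀ n - z‖ ≤
        (|1 - α| + α * cocoContr c σ β) ^ n * ‖z₀ - z‖) ∧
      (∀ n, ‖jb (kmIter (reflComp ja jb) α z₀ n) - jb z‖ ≤
        (|1 - α| + α * cocoContr c σ β) ^ n * ‖z₀ - z‖) ∧
      Tendsto (kmIter (reflComp ja jb) α z₀) atTop (𝓝 z) := by
  obtain ⟨z, hz, hdr, hmem, h1, h2, h3⟩ := linearRate_of_contractive hja hjb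
    (hsm.isMonotone hσ.le) hB hc hα0.ne'
    (rate_nonneg_of_contractive (cocoContr_nonneg c σ β) hα0.le)
    (rate_lt_one_of_contractive (cocoContr_nonneg c σ β) (cocoContr_lt_one hc hσ hβ.le) hα0 hα)
    (norm_kmStep_sub_le_of_sm_coco_same hsm ha hja hjb hB hσ.le hβ hc hα0.le) z₀
  exact ⟨z, hz, hdr, Set.eq_singleton_iff_unique_mem.2
    ⟨hmem, fun x hx => hsm.subsingleton_zer_opSum hσ hB hx hmem⟩, h1, h2, h3⟩

end Literature.Analysis.Convex.DouglasRachfordLinearRate
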